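import Mathlib
import Summits.ResolutionOfSingularities.ResolutionOfSingularities.Theorems.WeightedInvariantLocalWeightedDropTOT2TopPrimesChartComap
import Summits.ResolutionOfSingularities.ResolutionOfSingularities.Theorems.WeightedInvariantLocalWeightedDropTOT2TopPrimesShearRecentre

/-!
# TOT2-LINE (P3) brick B4, composites: TOP-LOCUS PRIMES DESCEND ALONG `chart ∘ recentre ψ ∘ shear3 h`

Sub-problem `ResolutionOfSingularities`, ENGINE crux `stmt-ResolutionOfSingularities-8899` (`LocalWeightedDrop`), skeleton v35
(2e806da509994632), registered stub `stub_conflictBudget` (P3); B6-PLAN §4 of res-L1-w43-stub-2 (steps 5 TRANSLATED POINT and 6 GRAPH MOVE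
compose a chart with the coordinate change `recentre ψ ∘ shear3 h`).  [OURS · L1 W4.3 · chain w43 · res-L1-w43-lead-1 g6; def-free; nothing here
is a statement of any manuscript; AI-produced, gate-checked, weaker than expert review.]

The `hB4` hypotheses (dim-premise shape) of the two composite steps, as named theorems: B4-1 / B4-4 (`…TOT2TopPrimesChartComap`) followed by
B4-5 (`…TOT2TopPrimesShearRecentre`), in the nested-`comap` spelling and in the `AlgHom.comp` spelling.
* `comap_chartOne_recentre_shear3_mem_topPrimes` (+ `_comp`): translated point `Φ = (u₁,u₁u₂,u₁y) ∘ (y ↦ y+ψ) ∘ (u₂ ↦ u₂+u₁h)`,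
  successor label `blowOneT d (shift d (shearT h A) ψ)`;
* `comap_chartDivTwo_recentre_shear3_mem_topPrimes` (+ `_comp`): graph move `Φ = (u₁,u₂,u₂y) ∘ (y ↦ y+ψ) ∘ (u₂ ↦ u₂+u₁h)`,
  successor label `divTwoT d (shift d (shearT h A) ψ)`.
-/

set_option linter.dupNamespace false -- mandated namespace of this single-conjunct summit

noncomputable section

namespace Summit.ResolutionOfSingularities.ResolutionOfSingularities.Theorems

namespace TOT2Branch

open MvPowerSeries IsLocalRing PolyDescent MonicDescent WildMonic

variable {k : Type} [Field k]

/-- **hB4 FOR THE TRANSLATED POINT** (`Φ₁ ∘ recentre ψ ∘ shear3 h`, nested comaps): a one-dimensional top-locus prime of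
`blowOneT d (shift d (shearT h A) ψ)` not containing `u₁` pulls back to a top-locus prime of `A`. -/
theorem comap_chartOne_recentre_shear3_mem_topPrimes {d : ℕ} (hd : 0 < d) (A : Fin d → MvPowerSeries (Fin 2) k)
    (h ψ : MvPowerSeries (Fin 2) k) (hψ : constantCoeff ψ = 0) (hpos : IsPosT d (WildMonic.shift d (shearT h A) ψ))
    (hs : HasSubst (![X 0, X 0 * X 1, X 0 * X 2] : Fin 3 → MvPowerSeries (Fin 3) k))
    {P' : Ideal (MvPowerSeries (Fin 3) k)} (hP' : P' ∈ topPrimes d (blowOneT d (WildMonic.shift d (shearT h A) ψ)))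
    (hX : (X 0 : MvPowerSeries (Fin 3) k) ∉ P') (hdim' : ringKrullDim (MvPowerSeries (Fin 3) k ⧸ P') = 1) :
    ((P'.comap (substAlgHom hs : MvPowerSeries (Fin 3) k →ₐ[k] MvPowerSeries (Fin 3) k)).comap
        (substAlgHom (hasSubst_of_constantCoeff_zero (NCPoly.constantCoeff_recentre hψ)) :
          MvPowerSeries (Fin 3) k →ₐ[k] MvPowerSeries (Fin 3) k)).comap
      (substAlgHom (hasSubst_of_constantCoeff_zero (MonicDescent.constantCoeff_shear3 h)) :
        MvPowerSeries (Fin 3) k →ₐ[k] MvPowerSeries (Fin 3) k) ∈ topPrimes d A :=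
  comap_shearRecentre_mem_topPrimes A h ψ hψ (comap_chartOne_mem_topPrimes hd _ hpos hP' hX hdim')

/-- The same through the composite algebra map `Φ₁.comp (recentre.comp shear3)`. -/
theorem comap_chartOne_recentre_shear3_mem_topPrimes_comp {d : ℕ} (hd : 0 < d) (A : Fin d → MvPowerSeries (Fin 2) k)
    (h ψ : MvPowerSeries (Fin 2) k) (hψ : constantCoeff ψ = 0) (hpos : IsPosT d (WildMonic.shift d (shearT h A) ψ))
    (hs : HasSubst (![X 0, X 0 * X 1, X 0 * X 2] : Fin 3 → MvPowerSeries (Fin 3) k))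
    {P' : Ideal (MvPowerSeries (Fin 3) k)} (hP' : P' ∈ topPrimes d (blowOneT d (WildMonic.shift d (shearT h A) ψ)))
    (hX : (X 0 : MvPowerSeries (Fin 3) k) ∉ P') (hdim' : ringKrullDim (MvPowerSeries (Fin 3) k ⧸ P') = 1) :
    P'.comap ((substAlgHom hs : MvPowerSeries (Fin 3) k →ₐ[k] MvPowerSeries (Fin 3) k).comp
      ((substAlgHom (hasSubst_of_constantCoeff_zero (NCPoly.constantCoeff_recentre hψ)) :
          MvPowerSeries (Fin 3) k →ₐ[k] MvPowerSeries (Fin 3) k).comp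
        (substAlgHom (hasSubst_of_constantCoeff_zero (MonicDescent.constantCoeff_shear3 h)) :
          MvPowerSeries (Fin 3) k →ₐ[k] MvPowerSeries (Fin 3) k))) ∈ topPrimes d A := by
  have hc : P'.comap ((substAlgHom hs : MvPowerSeries (Fin 3) k →ₐ[k] MvPowerSeries (Fin 3) k).comp
      ((substAlgHom (hasSubst_of_constantCoeff_zero (NCPoly.constantCoeff_recentre hψ)) :
          MvPowerSeries (Fin 3) k →ₐ[k] MvPowerSeries (Fin 3) k).comp
        (substAlgHom (hasSubst_of_constantCoeff_zero (MonicDescent.constantCoeff_shear3 h)) :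
          MvPowerSeries (Fin 3) k →ₐ[k] MvPowerSeries (Fin 3) k))) =
      ((P'.comap (substAlgHom hs : MvPowerSeries (Fin 3) k →ₐ[k] MvPowerSeries (Fin 3) k)).comap
        (substAlgHom (hasSubst_of_constantCoeff_zero (NCPoly.constantCoeff_recentre hψ)) :
          MvPowerSeries (Fin 3) k →ₐ[k] MvPowerSeries (Fin 3) k)).comap
      (substAlgHom (hasSubst_of_constantCoeff_zero (MonicDescent.constantCoeff_shear3 h)) :
        MvPowerSeries (Fin 3) k →ₐ[k] MvPowerSeries (Fin 3) k) :=
    Ideal.ext fun x => by rw [Ideal.mem_comap, Ideal.mem_comap, Ideal.mem_comap, Ideal.mem_comap, AlgHom.comp_apply, AlgHom.comp_apply]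
  rw [hc]
  exact comap_chartOne_recentre_shear3_mem_topPrimes hd A h ψ hψ hpos hs hP' hX hdim'

/-- **hB4 FOR THE GRAPH MOVE** (`(u₁,u₂,u₂y) ∘ recentre ψ ∘ shear3 h`, nested comaps): a one-dimensional top-locus prime of
`divTwoT d (shift d (shearT h A) ψ)` not containing `u₂` pulls back to a top-locus prime of `A`. -/
theorem comap_chartDivTwo_recentre_shear3_mem_topPrimes {d : ℕ} (hd : 0 < d) (A : Fin d → MvPowerSeries (Fin 2) k)
    (h ψ : MvPowerSeries (Fin 2) k) (hψ : constantCoeff ψ = 0) (hperm : IsPermissibleTwoT d (WildMonic.shift d (shearT h A) ψ))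
    (hs : HasSubst (![X 0, X 1, X 1 * X 2] : Fin 3 → MvPowerSeries (Fin 3) k))
    {P' : Ideal (MvPowerSeries (Fin 3) k)} (hP' : P' ∈ topPrimes d (divTwoT d (WildMonic.shift d (shearT h A) ψ)))
    (hX : (X 1 : MvPowerSeries (Fin 3) k) ∉ P') (hdim' : ringKrullDim (MvPowerSeries (Fin 3) k ⧸ P') = 1) :
    ((P'.comap (substAlgHom hs : MvPowerSeries (Fin 3) k →ₐ[k] MvPowerSeries (Fin 3) k)).comap
        (substAlgHom (hasSubst_of_constantCoeff_zero (NCPoly.constantCoeff_recentre hψ)) :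
          MvPowerSeries (Fin 3) k →ₐ[k] MvPowerSeries (Fin 3) k)).comap
      (substAlgHom (hasSubst_of_constantCoeff_zero (MonicDescent.constantCoeff_shear3 h)) :
        MvPowerSeries (Fin 3) k →ₐ[k] MvPowerSeries (Fin 3) k) ∈ topPrimes d A :=
  comap_shearRecentre_mem_topPrimes A h ψ hψ (comap_chartDivTwo_mem_topPrimes hd _ hperm hP' hX hdim')

/-- The same through the composite algebra map `Φ₄.comp (recentre.comp shear3)`. -/
theorem comap_chartDivTwo_recentre_shear3_mem_topPrimes_comp {d : ℕ} (hd : 0 < d) (A : Fin d → MvPowerSeries (Fin 2) k)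
    (h ψ : MvPowerSeries (Fin 2) k) (hψ : constantCoeff ψ = 0) (hperm : IsPermissibleTwoT d (WildMonic.shift d (shearT h A) ψ))
    (hs : HasSubst (![X 0, X 1, X 1 * X 2] : Fin 3 → MvPowerSeries (Fin 3) k))
    {P' : Ideal (MvPowerSeries (Fin 3) k)} (hP' : P' ∈ topPrimes d (divTwoT d (WildMonic.shift d (shearT h A) ψ)))
    (hX : (X 1 : MvPowerSeries (Fin 3) k) ∉ P') (hdim' : ringKrullDim (MvPowerSeries (Fin 3) k ⧸ P') = 1) :
    P'.comap ((substAlgHom hs : MvPowerSeries (Fin 3) k →ₐ[k] MvPowerSeries (Fin 3) k).comp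
      ((substAlgHom (hasSubst_of_constantCoeff_zero (NCPoly.constantCoeff_recentre hψ)) :
          MvPowerSeries (Fin 3) k →ₐ[k] MvPowerSeries (Fin 3) k).comp
        (substAlgHom (hasSubst_of_constantCoeff_zero (MonicDescent.constantCoeff_shear3 h)) :
          MvPowerSeries (Fin 3) k →ₐ[k] MvPowerSeries (Fin 3) k))) ∈ topPrimes d A := by
  have hc : P'.comap ((substAlgHom hs : MvPowerSeries (Fin 3) k →ₐ[k] MvPowerSeries (Fin 3) k).comp
      ((substAlgHom (hasSubst_of_constantCoeff_zero (NCPoly.constantCoeff_recentre hψ)) :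
          MvPowerSeries (Fin 3) k →ₐ[k] MvPowerSeries (Fin 3) k).comp
        (substAlgHom (hasSubst_of_constantCoeff_zero (MonicDescent.constantCoeff_shear3 h)) :
          MvPowerSeries (Fin 3) k →ₐ[k] MvPowerSeries (Fin 3) k))) =
      ((P'.comap (substAlgHom hs : MvPowerSeries (Fin 3) k →ₐ[k] MvPowerSeries (Fin 3) k)).comap
        (substAlgHom (hasSubst_of_constantCoeff_zero (NCPoly.constantCoeff_recentre hψ)) :
          MvPowerSeries (Fin 3) k →ₐ[k] MvPowerSeries (Fin 3) k)).comap
      (substAlgHom (hasSubst_of_constantCoeff_zero (MonicDescent.constantCoeff_shear3 h)) :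
        MvPowerSeries (Fin 3) k →ₐ[k] MvPowerSeries (Fin 3) k) :=
    Ideal.ext fun x => by rw [Ideal.mem_comap, Ideal.mem_comap, Ideal.mem_comap, Ideal.mem_comap, AlgHom.comp_apply, AlgHom.comp_apply]
  rw [hc]
  exact comap_chartDivTwo_recentre_shear3_mem_topPrimes hd A h ψ hψ hperm hs hP' hX hdim'

end TOT2Branch

end Summit.ResolutionOfSingularities.ResolutionOfSingularities.Theorems

end
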